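import Literature.Analysis.Complex.LogDerivZerosDisc
import HarnessLib

/-!
# `log|f|` and the zeros in a disc (Titchmarsh §3.9, companion to Lemma α)

Trunk T-CA (`Literature/Analysis/Complex`). Everything in this file is PROVED; no named fact.

The tree's `Literature.Analysis.Complex.norm_logDeriv_sub_sum_le` (`LogDerivZerosDisc.lean`) is
Landau's lemma `f'/f(z) = Σ_ρ m(ρ)/(z − ρ) + O(M)` on a disc. The same proof — divide out the zeros
`P(z) = ∏ (z − ρ)^{m(ρ)}` of `f` in `|z − c| ≤ R₂`, bound `G = f/P` by the maximum principle, write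
`G = G(c)e^h` and bound `h` by Borel–Carathéodory — gives the integrated ("logarithm") form,
which is what mean values of `log|f|` along lines through the zeros require
(Titchmarsh Thm. 9.6 (B): `log ζ(s) = Σ_{|t−γ|≤1} log(s − ρ) + O(log t)`):

* `Literature.Analysis.Complex.log_norm_sub_sum_log_mem_Icc` — for `|z − c| ≤ r₁` with `f(z) ≠ 0`:
  `log|f(c)| − N log R₂ − (2r₁/(R₂ − r₁))·(log(B/|f(c)|) + N log(R/(R − R₂)) + 1)`
  `  ≤ log|f(z)| − Σ_ρ m(ρ) log|z − ρ| ≤ log B − N log(R − R₂)`;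
* `Literature.Analysis.Complex.log_norm_prod_pow_sub` — `log|∏(z − u)^{n(u)}| = Σ n(u) log|z − u|`.

Here `f` is holomorphic on `|z − c| ≤ R` with `f(c) ≠ 0`, `|f| ≤ B`, `0 < r₁ < R₂ < R`, the sum is
over the support of Mathlib's `divisor f (closedBall c R₂)` with its weights, `N` their total.
Applied to `ζ₁ = (s−1)ζ(s)` on the discs `|s − (2 + it)| ≤ 9/5 < 37/20 < 39/20` of
`Literature/NumberTheory/LFunctions/ZetaLogDerivDisc.lean` (where `N ≪ log(|t|+4)`) this is
Titchmarsh's Theorem 9.6 (B) in the form `|log|ζ₁(s)| − Σ m log|s − ρ|| ≪ log(|t| + 4)`, from which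
`∫_T^{T+1} |log|ζ(σ + it)|| dt ≪ log T` uniformly in `σ ≥ 1/4` follows.

## References

* E. C. Titchmarsh, *The Theory of the Riemann Zeta-Function*, 2nd ed. (rev. D. R. Heath-Brown),
  Oxford 1986, §3.9 Lemma α and its proof; Thm. 9.6 (B). [Titchmarsh1986]
* H. L. Montgomery, R. C. Vaughan, *Multiplicative Number Theory I*, CUP 2007, Lemma 6.3
  (Borel–Carathéodory). [MontgomeryVaughan2007]
-/

noncomputable section

open Complex Filter Set Metric MeromorphicOn Real Topology

namespace Literature.Analysis.Complex

variable {f : ℂ → ℂ} {c : ℂ}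

/-- `log` of the zero-polynomial: `log|∏ (z − u)^{n(u)}| = Σ n(u) log|z − u|` off the zeros.
[folklore] -/
theorem log_norm_prod_pow_sub {S : Finset ℂ} (n : ℂ → ℕ) {z : ℂ} (hz : ∀ a ∈ S, z ≠ a) :
    Real.log ‖∏ u ∈ S, (z - u) ^ n u‖ = ∑ u ∈ S, (n u : ℝ) * Real.log ‖z - u‖ := by
  rw [norm_prod, Real.log_prod]
  · refine Finset.sum_congr rfl fun u hu ↦ ?_
    rw [norm_pow, Real.log_pow]
  · intro u hu
    rw [norm_pow]
    exact pow_ne_zero _ (norm_ne_zero_iff.2 (sub_ne_zero.2 (hz u hu)))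

/-- **`log|f|` against the zeros in a disc (Titchmarsh §3.9, logarithmic form of Lemma α).**
Let `f` be holomorphic on `|z − c| ≤ R` with `f(c) ≠ 0` and `|f| ≤ B` there, `0 < r₁ < R₂ < R`, and
let `ρ` run over the zeros of `f` in `|z − c| ≤ R₂` with multiplicities `m(ρ)` (Mathlib's
`divisor`), `N = Σ m(ρ)`. Then for `|z − c| ≤ r₁` with `f(z) ≠ 0`,

`log|f(c)| − N log R₂ − (2r₁/(R₂ − r₁))·(log(B/|f(c)|) + N log(R/(R − R₂)) + 1)`
`   ≤ log|f(z)| − Σ_ρ m(ρ) log|z − ρ| ≤ log B − N log(R − R₂)`.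

(Write `f = P·G`, `P = ∏ (z − ρ)^{m(ρ)}`; then `|G| ≤ B/(R − R₂)^N` on `|z − c| = R` hence inside,
`|G(c)| ≥ |f(c)|/R₂^N`, `G = G(c)e^h` on `|z − c| < R₂` with `Re h ≤ M − 1`,
`M = log(B/|f(c)|) + N log(R/(R − R₂)) + 1`, and Borel–Carathéodory gives
`|h| ≤ 2Mr₁/(R₂ − r₁)` on `|z − c| ≤ r₁`; finally `log|G(z)| = log|G(c)| + Re h(z)`.)
[cite: Titchmarsh1986, §3.9 Lemma α (proof)] -/
theorem log_norm_sub_sum_log_mem_Icc {r₁ R₂ R B : ℝ} (hr₁ : 0 < r₁) (hR₂ : r₁ < R₂) (hR : R₂ < R)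
    (hf : AnalyticOnNhd ℂ f (closedBall c R)) (hc : f c ≠ 0)
    (hB : ∀ z ∈ closedBall c R, ‖f z‖ ≤ B) {z : ℂ} (hz : z ∈ closedBall c r₁) (hfz : f z ≠ 0) :
    Real.log ‖f c‖ -
          (∑ u ∈ ((divisor f (closedBall c R₂)).finiteSupport (isCompact_closedBall c R₂)).toFinset,
            (divisor f (closedBall c R₂) u : ℝ)) * Real.log R₂ -
          2 * r₁ / (R₂ - r₁) * (Real.log (B / ‖f c‖) +
            (∑ u ∈ ((divisor f (closedBall c R₂)).finiteSupport (isCompact_closedBall c R₂)).toFinset,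
              (divisor f (closedBall c R₂) u : ℝ)) * Real.log (R / (R - R₂)) + 1) ≤
        Real.log ‖f z‖ -
          ∑ u ∈ ((divisor f (closedBall c R₂)).finiteSupport (isCompact_closedBall c R₂)).toFinset,
            (divisor f (closedBall c R₂) u : ℝ) * Real.log ‖z - u‖ ∧
      Real.log ‖f z‖ -
          ∑ u ∈ ((divisor f (closedBall c R₂)).finiteSupport (isCompact_closedBall c R₂)).toFinset,
            (divisor f (closedBall c R₂) u : ℝ) * Real.log ‖z - u‖ ≤
        Real.log B -
          (∑ u ∈ ((divisor f (closedBall c R₂)).finiteSupport (isCompact_closedBall c R₂)).toFinset,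
            (divisor f (closedBall c R₂) u : ℝ)) * Real.log (R - R₂) := by
  classical
  have hR₂0 : 0 < R₂ := hr₁.trans hR₂
  have hR0 : 0 < R := hR₂0.trans hR
  have hRR₂ : 0 < R - R₂ := sub_pos.2 hR
  set U₂ := closedBall c R₂ with hU₂
  set D := divisor f U₂ with hD
  set S := (D.finiteSupport (isCompact_closedBall c R₂)).toFinset with hS
  set n : ℂ → ℕ := fun u ↦ (D u).toNat with hn
  set P : ℂ → ℂ := fun w ↦ ∏ u ∈ S, (w - u) ^ n u with hP
  have hf₂ : AnalyticOnNhd ℂ f U₂ := hf.mono (closedBall_subset_closedBall hR.le)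
  obtain ⟨G, hG_an, hG_ne, hfPG⟩ := exists_eq_prod_pow_sub_mul hR₂0 hR.le hf hc
  -- memberships
  have hzc : ‖z - c‖ ≤ r₁ := by rwa [mem_closedBall, dist_eq_norm] at hz
  have hz₂ : z ∈ ball c R₂ := by
    rw [mem_ball, dist_eq_norm]; linarith
  have hzU₂ : z ∈ U₂ := ball_subset_closedBall hz₂
  have hzR : z ∈ closedBall c R := by
    rw [mem_closedBall, dist_eq_norm]; linarith
  have hcU₂ : c ∈ U₂ := mem_closedBall_self hR₂0.le
  have hcR : c ∈ closedBall c R := mem_closedBall_self hR0.le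
  have hfc : 0 < ‖f c‖ := norm_pos_iff.2 hc
  have hBc : ‖f c‖ ≤ B := hB c hcR
  have hB0 : 0 < B := hfc.trans_le hBc
  -- multiplicities
  have hD0 : ∀ u, 0 ≤ D u := fun u ↦ hf₂.divisor_nonneg u
  have hSU : ∀ u ∈ S, u ∈ U₂ := fun u hu ↦
    D.supportWithinDomain ((Finite.mem_toFinset _).1 hu)
  have hSc : ∀ u ∈ S, ‖c - u‖ ≤ R₂ := by
    intro u hu
    have := hSU u hu
    rw [mem_closedBall, dist_eq_norm, norm_sub_rev] at this
    exact this
  set N : ℕ := ∑ u ∈ S, n u with hN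
  have hnR : ∀ u, ((n u : ℕ) : ℝ) = (D u : ℝ) := by
    intro u
    simp only [hn]
    conv_rhs => rw [← Int.toNat_of_nonneg (hD0 u)]
    exact (Int.cast_natCast _).symm
  have hNR : (N : ℝ) = ∑ u ∈ S, (D u : ℝ) := by
    rw [hN]; push_cast; exact Finset.sum_congr rfl fun u _ ↦ hnR u
  have hPnorm : ∀ w, ‖P w‖ = ∏ u ∈ S, ‖w - u‖ ^ n u := by
    intro w
    rw [hP, norm_prod]
    exact Finset.prod_congr rfl fun u _ ↦ norm_pow _ _
  -- D z = 0 (f z ≠ 0), so z ∉ S and P z ≠ 0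
  have hDz : D z = 0 := by
    rw [hD, hf₂.divisor_apply hzU₂, ((hf₂ z hzU₂).analyticOrderAt_eq_zero).2 hfz]
    rfl
  have hzS : z ∉ S := by
    rw [hS, Finite.mem_toFinset, Function.mem_support]
    exact fun h ↦ h hDz
  have hzS' : ∀ a ∈ S, z ≠ a := fun a ha h ↦ hzS (h ▸ ha)
  have hPz : P z ≠ 0 := prod_pow_sub_ne_zero _ hzS'
  -- ‖P c‖ ≤ R₂ ^ N
  have hPc : ‖P c‖ ≤ R₂ ^ N := by
    rw [hPnorm, hN, ← Finset.prod_pow_eq_pow_sum]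
    refine Finset.prod_le_prod (fun u _ ↦ by positivity) fun u hu ↦ ?_
    exact pow_le_pow_left₀ (norm_nonneg _) (hSc u hu) _
  -- ‖P s‖ ≥ (R - R₂) ^ N on the sphere
  have hPs : ∀ s ∈ sphere c R, (R - R₂) ^ N ≤ ‖P s‖ := by
    intro s hs
    rw [mem_sphere, dist_eq_norm] at hs
    rw [hPnorm, hN, ← Finset.prod_pow_eq_pow_sum]
    refine Finset.prod_le_prod (fun u _ ↦ by positivity) fun u hu ↦ ?_
    refine pow_le_pow_left₀ hRR₂.le ?_ _
    have h1 := norm_sub_norm_le (s - c) (u - c)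
    rw [show s - c - (u - c) = s - u by ring, hs, norm_sub_rev u c] at h1
    linarith [hSc u hu]
  -- G on the sphere
  set C₀ : ℝ := B / (R - R₂) ^ N with hC₀
  have hGs : ∀ s ∈ sphere c R, ‖G s‖ ≤ C₀ := by
    intro s hs
    have hsR : s ∈ closedBall c R := sphere_subset_closedBall hs
    have hPs' := hPs s hs
    have h1 : ‖f s‖ = ‖P s‖ * ‖G s‖ := by rw [hfPG s hsR, norm_mul]
    rw [hC₀, le_div_iff₀ (pow_pos hRR₂ N)]
    calc ‖G s‖ * (R - R₂) ^ N ≤ ‖G s‖ * ‖P s‖ :=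
          mul_le_mul_of_nonneg_left hPs' (norm_nonneg _)
      _ = ‖f s‖ := by rw [h1, mul_comm]
      _ ≤ B := hB s hsR
  -- maximum modulus
  have hGd : DifferentiableOn ℂ G (closedBall c R) := hG_an.differentiableOn
  have hGmax : ∀ w ∈ closedBall c R, ‖G w‖ ≤ C₀ := by
    intro w hw
    refine Complex.norm_le_of_forall_mem_frontier_norm_le (U := ball c R) isBounded_ball ?_ ?_ ?_
    · apply DifferentiableOn.diffContOnCl
      rwa [closure_ball c hR0.ne']
    · rwa [frontier_ball c hR0.ne']
    · rwa [closure_ball c hR0.ne']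
  -- ‖G c‖ ≥ ‖f c‖ / R₂ ^ N
  have hGc0 : G c ≠ 0 := hG_ne c hcU₂
  have hGz0 : G z ≠ 0 := hG_ne z hzU₂
  have hGc : ‖f c‖ ≤ R₂ ^ N * ‖G c‖ := by
    rw [hfPG c hcR, norm_mul]
    exact mul_le_mul_of_nonneg_right hPc (norm_nonneg _)
  -- the exponent M
  set M₀ : ℝ := Real.log (B / ‖f c‖) + N * Real.log (R / (R - R₂)) with hM₀
  set M : ℝ := M₀ + 1 with hM
  have hlog1 : 0 ≤ Real.log (B / ‖f c‖) := Real.log_nonneg ((one_le_div hfc).2 hBc)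
  have hlog2 : 0 ≤ Real.log (R / (R - R₂)) :=
    Real.log_nonneg ((one_le_div hRR₂).2 (by linarith))
  have hM₀0 : 0 ≤ M₀ := by positivity
  have hMpos : 0 < M := by linarith
  have hexpM₀ : Real.exp M₀ = B / ‖f c‖ * (R / (R - R₂)) ^ N := by
    rw [hM₀, Real.exp_add, Real.exp_log (div_pos hB0 hfc), ← Real.log_pow,
      Real.exp_log (pow_pos (div_pos hR0 hRR₂) N)]
  have hC₀le : C₀ ≤ Real.exp M₀ * ‖G c‖ := by
    rw [hexpM₀, hC₀]
    have hGc' : ‖f c‖ / R₂ ^ N ≤ ‖G c‖ := by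
      rw [div_le_iff₀ (pow_pos hR₂0 N)]; linarith
    calc B / (R - R₂) ^ N = B / ‖f c‖ * (R / (R - R₂)) ^ N * (‖f c‖ / R ^ N) := by
          field_simp
          rw [← mul_pow, mul_div_cancel₀ _ hRR₂.ne']
        _ ≤ B / ‖f c‖ * (R / (R - R₂)) ^ N * (‖f c‖ / R₂ ^ N) := by
          gcongr
        _ ≤ B / ‖f c‖ * (R / (R - R₂)) ^ N * ‖G c‖ := by
          gcongr
  have hGle : ∀ w ∈ closedBall c R, ‖G w‖ ≤ Real.exp M₀ * ‖G c‖ := fun w hw ↦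
    (hGmax w hw).trans hC₀le
  -- the primitive h of G'/G on the ball |w - c| < R₂
  have hG_ne' : ∀ w ∈ ball c R₂, G w ≠ 0 := fun w hw ↦ hG_ne w (ball_subset_closedBall hw)
  have hGan' : ∀ w ∈ ball c R₂, AnalyticAt ℂ G w := fun w hw ↦
    hG_an w (closedBall_subset_closedBall hR.le (ball_subset_closedBall hw))
  have hLd : DifferentiableOn ℂ (logDeriv G) (ball c R₂) := by
    intro w hw
    have h1 : DifferentiableAt ℂ (deriv G) w := (hGan' w hw).deriv.differentiableAt
    have h2 : DifferentiableAt ℂ G w := (hGan' w hw).differentiableAt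
    exact ((h1.div h2 (hG_ne' w hw)).differentiableWithinAt).congr (fun _ _ ↦ rfl) rfl
  obtain ⟨h, hh0, hh⟩ := hLd.isExactOn_ball.with_val_at c 0
  have hhd : DifferentiableOn ℂ h (ball c R₂) := fun w hw ↦
    (hh w hw).differentiableAt.differentiableWithinAt
  -- G = G(c) exp h on the ball
  have hGexp : ∀ w ∈ ball c R₂, G w = G c * Complex.exp (h w) := by
    have hφd : DifferentiableOn ℂ (fun w ↦ G w * Complex.exp (-h w)) (ball c R₂) := by
      intro w hw
      exact (((hGan' w hw).differentiableAt).mul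
        ((hh w hw).differentiableAt.neg.cexp)).differentiableWithinAt
    have hφ' : (ball c R₂).EqOn (deriv fun w ↦ G w * Complex.exp (-h w)) 0 := by
      intro w hw
      have h1 : HasDerivAt G (deriv G w) w := (hGan' w hw).differentiableAt.hasDerivAt
      have h2 : HasDerivAt (fun w ↦ Complex.exp (-h w)) (Complex.exp (-h w) * -(logDeriv G w)) w :=
        (hh w hw).neg.cexp
      rw [(h1.fun_mul h2).deriv, Pi.zero_apply, logDeriv_apply]
      field_simp [hG_ne' w hw]
      ring
    intro w hw
    have := isOpen_ball.is_const_of_deriv_eq_zero (convex_ball c R₂).isPreconnected hφd hφ' hw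
      (mem_ball_self hR₂0)
    simp only [hh0, neg_zero, Complex.exp_zero, mul_one] at this
    rw [← this, mul_assoc, ← Complex.exp_add, neg_add_cancel, Complex.exp_zero, mul_one]
  -- Re h ≤ M₀ on the ball
  have hRe : ∀ w ∈ ball c R₂, (h w).re ≤ M₀ := by
    intro w hw
    have hwR : w ∈ closedBall c R := closedBall_subset_closedBall hR.le (ball_subset_closedBall hw)
    have h1 := hGle w hwR
    rw [hGexp w hw, norm_mul, Complex.norm_exp, mul_comm] at h1
    have h2 : Real.exp (h w).re ≤ Real.exp M₀ :=
      le_of_mul_le_mul_right h1 (norm_pos_iff.2 hGc0)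
    exact Real.exp_le_exp.1 h2
  -- Borel–Carathéodory: |h| ≤ 2 M r₁ / (R₂ - r₁) on |w - c| ≤ r₁
  set H : ℝ := 2 * M * r₁ / (R₂ - r₁) with hH
  have hBC : ‖h z‖ ≤ H := by
    set h₀ : ℂ → ℂ := fun w ↦ h (c + w) with hh₀
    have hmem : ∀ w ∈ ball (0 : ℂ) R₂, c + w ∈ ball c R₂ := by
      intro w hw
      rw [mem_ball, dist_eq_norm] at hw ⊢
      simpa using hw
    have hd₀ : DifferentiableOn ℂ h₀ (ball 0 R₂) := by
      intro w hw
      exact ((hh (c + w) (hmem w hw)).differentiableAt.comp w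
        ((differentiableAt_id).const_add c)).differentiableWithinAt
    have hmaps : MapsTo h₀ (ball 0 R₂) {z | z.re ≤ M} := by
      intro w hw
      simp only [mem_setOf_eq, hh₀]
      exact (hRe _ (hmem w hw)).trans (by linarith)
    have hv' : z - c ∈ ball (0 : ℂ) R₂ := by
      rw [mem_ball, dist_zero_right]; linarith
    have hbc := Complex.borelCaratheodory_zero hMpos hd₀ hmaps hR₂0 hv' (by simp [hh₀, hh0])
    simp only [hh₀, add_sub_cancel] at hbc
    refine hbc.trans ?_
    rw [hH, div_le_div_iff₀ (by linarith) (by linarith)]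
    have hM2 : 0 ≤ 2 * M := by linarith
    nlinarith [mul_le_mul_of_nonneg_left hzc hM2, norm_nonneg (z - c)]
  -- the logarithms
  have hfz_eq : ‖f z‖ = ‖P z‖ * ‖G z‖ := by rw [hfPG z hzR, norm_mul]
  have hPz0 : 0 < ‖P z‖ := norm_pos_iff.2 hPz
  have hGzpos : 0 < ‖G z‖ := norm_pos_iff.2 hGz0
  have hGcpos : 0 < ‖G c‖ := norm_pos_iff.2 hGc0
  have hlogf : Real.log ‖f z‖ = Real.log ‖P z‖ + Real.log ‖G z‖ := by
    rw [hfz_eq, Real.log_mul hPz0.ne' hGzpos.ne']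
  have hlogP : Real.log ‖P z‖ = ∑ u ∈ S, (D u : ℝ) * Real.log ‖z - u‖ := by
    rw [show P z = ∏ u ∈ S, (z - u) ^ n u from rfl, log_norm_prod_pow_sub n hzS']
    exact Finset.sum_congr rfl fun u _ ↦ by rw [hnR u]
  have hdiff : Real.log ‖f z‖ - ∑ u ∈ S, (D u : ℝ) * Real.log ‖z - u‖ = Real.log ‖G z‖ := by
    rw [hlogf, hlogP]; ring
  rw [hdiff, ← hNR]
  constructor
  · -- lower bound: log ‖G z‖ = log ‖G c‖ + Re h z ≥ log ‖f c‖ - N log R₂ - H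
    have hGz_eq : ‖G z‖ = ‖G c‖ * Real.exp (h z).re := by
      rw [hGexp z hz₂, norm_mul, Complex.norm_exp]
    have hlogGz : Real.log ‖G z‖ = Real.log ‖G c‖ + (h z).re := by
      rw [hGz_eq, Real.log_mul hGcpos.ne' (Real.exp_pos _).ne', Real.log_exp]
    have hlogGc : Real.log ‖f c‖ - N * Real.log R₂ ≤ Real.log ‖G c‖ := by
      have h1 : Real.log ‖f c‖ ≤ Real.log (R₂ ^ N * ‖G c‖) := Real.log_le_log hfc hGc
      rw [Real.log_mul (pow_pos hR₂0 N).ne' hGcpos.ne', Real.log_pow] at h1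
      linarith
    have hre : -H ≤ (h z).re := by
      have := (abs_re_le_norm (h z)).trans hBC
      exact (abs_le.1 this).1
    have hHeq : H = 2 * r₁ / (R₂ - r₁) * M := by rw [hH]; ring
    rw [hlogGz]
    have : 2 * r₁ / (R₂ - r₁) * (Real.log (B / ‖f c‖) + N * Real.log (R / (R - R₂)) + 1) = H := by
      rw [hHeq, hM, hM₀]
    linarith
  · -- upper bound: log ‖G z‖ ≤ log C₀ = log B - N log (R - R₂)
    have h1 : Real.log ‖G z‖ ≤ Real.log C₀ := Real.log_le_log hGzpos (hGmax z hzR)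
    have h2 : Real.log C₀ = Real.log B - N * Real.log (R - R₂) := by
      rw [hC₀, Real.log_div hB0.ne' (pow_pos hRR₂ N).ne', Real.log_pow]
    linarith

end Literature.Analysis.Complex
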